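import Summits.QuantumFields.BalabanUV.Beta.FP.TorusNestedReadoutRows

/-!
# `BalabanUV.Beta.FP.TorusCombTranslate` — road «FP», binder row D1, ROUTE T (β1), STUB P of the row's ONE file, (C) part 1 of 5 (an2 g76 A-2 ∕ J-NOTE-20 §8, R-AN2-76-PB's VALUE
# half «general-box read-out = reference read-out on each block»): **GENERIC RE-INDEXING ∕ BLOCK-INVERSE LEMMAS, THE COMB GEOMETRY UNDER BLOCK TRANSLATIONS, AND THE SLOT
# CORRESPONDENCE BETWEEN TWO TOWERS**

WHY.  (A1)(A2)(B) (`FP/TorusNestedReadoutRows ∕ …Locality ∕ QstepSymTwoBlock`) prove that the wrapper's tree-gauge read-out `E·(N·W₀)⁻¹·N` is big-block-LOCAL (support form).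
(P-c) needs its VALUE form: the read-out of the box `M` on the big block of a finest site equals the read-out of ANY other box `M′` (e.g. the one-block reference torus
`M′ = fun _ => Lc`) on the corresponding block, fed with the translated column.  Parts 1–5 prove this for two arbitrary towers.
SETTING (parts 1–5 of (C)).  Two towers over top tori `M`, `M′` (`Lc ∣ M i`, `Lc ∣ M′ i`), same `Lc`, `lev`, `rs`, depth `n+1`; a block shift `v : Site (d+1)`: top sites move by
`Lc • v`, the finest sites by `bigRatio Lc (n+1) • v = Lc^(n+2) • v`; slots correspond («Corr») when the sites of `towerEquiv⁻¹` differ by that shift, finest bonds when their base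
points do (same direction).  Objects as in parts (A1)(A2): `N := fromRows (τ₂·Q₁₀) τ₁` (letter `hN`), `Q₁₀ = compRowsG Lc Q M lev rs (n+1)` for a GENERIC `Q : StepRows d Lc`
under the displayed letters (TB) (two-block support of non-wrapping rows) and (TQ) (block-translation covariance of non-wrapping rows:
`↑a′ = ↑a + Lc•v → ↑b′ = ↑b + Lc•(Lc•v) → ↑a + e_ν ∈ pbox M → ↑a′ + e_ν ∈ pbox M′ → Q M ℓ r (a,ν) (b,κ) = Q M′ ℓ r (a′,ν) (b′,κ)`), both discharged at the record's `QSym Lc`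
(`FP/QstepSymTwoBlock`, `FP/QstepSymBlockTranslate`); `τ₁ = bigP` of the lower tower, `τ₂ = combF`, `W₀ = towerGen`, `E = towerEvalC`.

WHAT, this part ([folklore]; no `def`, no `def … : Prop`, nothing cited, 0 sorry, default heartbeats): §0 generic: **`sum_eq_sum_of_rel`** (two finite sums agree along a left- and
right-unique correspondence of their supports carrying equal terms — `Finset.sum_bij_ne_zero`), **`inv_submatrix_block`** (for a block-diagonal invertible matrix the block of the
inverse is the inverse of the block), **`inv_apply_eq_of_block_equiv ∕ inv_apply_eq_of_block_rel`** (two block-diagonal invertible matrices agreeing on corresponding blocks have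
inverses agreeing there — `Matrix.inv_submatrix_equiv`; relational form along a block-preserving one-to-one correspondence); §1 the comb geometry is covariant under
`x ↦ x + N•w`: `quo ∕ rootOf ∕ devSet ∕ axisOf ∕ signOf ∕ stepOf ∕ baseOf ∕ tipOf _add_zsmul`, `ne_rootOf_add_zsmul_iff`; §2 the slot correspondence: **`corr_succ_inl`** (a slot
corresponding to a TOP slot `inl t̄` is the top slot `inl t̄′` with `t̄′ = t̄ + Lc•v` — a lower slot's site is a NON-root of the lower big comb, a top slot's site a root:
`lift_eq_rootOf`), **`corr_succ_inr`** (a slot corresponding to a lower slot is a lower slot, corresponding under the lower tower's shift `bigRatio Lc k • (Lc•v)`),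
`bigRatio_succ_zsmul`.
WHAT THIS IS NOT: not (P-c) itself (the lattice `λℤ` as a `def`, its `Mc B`-periodisation = `lv` — the row's, on top of this identity); `hlve` NOT instantiated; no row of
v9∕v10 discharged; nothing of Bałaban's asserted, valued or discharged; 0 estimates; 0∕4 row-D1 binders (hW, hR, D1Tel, D1Rep); ROOT M‴ p325680 untouched; NOT (C1), NOT (L2′),
NOT (T-ID), NOT SDF, NOT D1, NEVER «G-an2-4 closed», NOT BetaPertH, NOT continuum, NOT Clay.

HONEST DEPENDENCY (page 1, mandatory): continuum YM on T⁴ ⇐ BetaPertH ∧ nine spine estimates (0/9 proved); BetaPertH ⇐ (D1) ∧ (D4) ∧ CAP+tail;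
G-an2-4 gates asym, D1 and NE2/3/4.  HONEST FRAMING (cell contract, verbatim): «discharging `BetaPertH` makes Bałaban's UV stability UNCONDITIONAL —
a real constructive-QFT result; it is NOT the continuum limit and NOT the Clay problem.»  ABSOLUTE RULE (cell charter, verbatim): «No internally-minted
statement may enter as a cited fact. Every hypothesis is either kernel-proved in this package or a verbatim quotation of a PUBLISHED theorem with page
reference. The manuscript(s) under audit are NOT citable for their own disputed steps — they are the thing under adjudication; programme-internal
(2001/route/tribunal) claims are never citable.»  Road «FP» OWNER, b2b-balaban-beta-d1-p3 gen 54, 2026-08-29.  No existing file touched.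
-/

noncomputable section

namespace Summit.QuantumFields.BalabanUV.Beta.FP.TorusCombTranslate

open Matrix Finset
open scoped BigOperators
open Literature.MathematicalPhysics.QuantumFieldTheory
open Literature.MathematicalPhysics.QuantumFieldTheory.Balaban1983to89
open Literature.MathematicalPhysics.QuantumFieldTheory.Balaban1983to89.Beta
open B5Prop11Plancherel (fine)
open B6Lemma24Torus (pbox mem_pbox)
open AffineAveraging (Site toSite unitVec)
open OneStepResolventKernel (Fib)
open Literature.MathematicalPhysics.QuantumFieldTheory.LatticeForm (quo)
open Summit.QuantumFields.BalabanUV.Beta.FP.TorusCombForest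
open Summit.QuantumFields.BalabanUV.Beta.FP.TorusCombRows (Res)
open Summit.QuantumFields.BalabanUV.Beta.FP.TorusCombNestedBasis (quo_lift lift_eq_rootOf)
open Summit.QuantumFields.BalabanUV.Beta.FP.TorusCompositeObjects
open Summit.QuantumFields.BalabanUV.Beta.FP.TorusNestedReadoutRows (inv_apply_eq_zero_of_blockDiagonal)
open Summit.QuantumFields.BalabanUV.Beta.GAN24.StaircaseFaces (quo_quo)

variable {d : ℕ}

/-! ## §0 Generic: re-indexing a finite sum along a one-to-one correspondence of the supports; the inverse of a block -/

section Generic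

/-- [folklore] **TWO FINITE SUMS AGREE ALONG A ONE-TO-ONE CORRESPONDENCE OF THEIR SUPPORTS**: `R` left- and right-unique, every nonzero term on either side has a partner,
partners carry equal terms. -/
theorem sum_eq_sum_of_rel {ι ι' : Type*} [Fintype ι] [Fintype ι'] (f : ι → ℝ) (g : ι' → ℝ) (R : ι → ι' → Prop)
    (hru : ∀ i i' j', R i i' → R i j' → i' = j') (hlu : ∀ i j i', R i i' → R j i' → i = j)
    (hf : ∀ i, f i ≠ 0 → ∃ i', R i i') (hg : ∀ i', g i' ≠ 0 → ∃ i, R i i') (hfg : ∀ i i', R i i' → f i = g i') :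
    ∑ i, f i = ∑ i', g i' := by
  classical
  refine Finset.sum_bij_ne_zero (fun i _ hne => Classical.choose (hf i hne)) (fun i _ hne => Finset.mem_univ _)
    (fun i₁ _ h₁ i₂ _ h₂ e => ?_) (fun i' _ hne => ?_) (fun i _ hne => hfg i _ (Classical.choose_spec (hf i hne)))
  · exact hlu i₁ i₂ _ (Classical.choose_spec (hf i₁ h₁)) (e ▸ Classical.choose_spec (hf i₂ h₂))
  · obtain ⟨i, hi⟩ := hg i' hne
    have hfi : f i ≠ 0 := by rw [hfg i i' hi]; exact hne
    exact ⟨i, Finset.mem_univ _, hfi, hru i _ _ (Classical.choose_spec (hf i hfi)) hi⟩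

/-- [folklore] **THE BLOCK OF THE INVERSE IS THE INVERSE OF THE BLOCK** for a block-diagonal invertible matrix: with `P` a block (the matrix vanishes from `P` to its
complement), `(A⁻¹)↾P = (A↾P)⁻¹`. -/
theorem inv_submatrix_block {ι : Type*} [Fintype ι] [DecidableEq ι] (A : Matrix ι ι ℝ) (hA : IsUnit A.det) (P : ι → Prop) [DecidablePred P]
    (hP : ∀ i j, P i → ¬ P j → A i j = 0) :
    (A⁻¹).submatrix (Subtype.val : {i // P i} → ι) (Subtype.val : {i // P i} → ι)
      = (A.submatrix (Subtype.val : {i // P i} → ι) (Subtype.val : {i // P i} → ι))⁻¹ := by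
  symm
  apply Matrix.inv_eq_right_inv
  ext i j
  have key : ∑ k : ι, A i.1 k * A⁻¹ k j.1 = ∑ k : {i // P i}, A i.1 k.1 * A⁻¹ k.1 j.1 := by
    rw [← Fintype.sum_subtype_add_sum_subtype P (fun k => A i.1 k * A⁻¹ k j.1)]
    have h0 : ∑ k : {a // ¬ P a}, A i.1 k.1 * A⁻¹ k.1 j.1 = 0 := Finset.sum_eq_zero fun k _ => by rw [hP i.1 k.1 i.2 k.2, zero_mul]
    rw [h0, add_zero]
  have e1 : ((A.submatrix (Subtype.val : {i // P i} → ι) (Subtype.val : {i // P i} → ι))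
      * (A⁻¹).submatrix (Subtype.val : {i // P i} → ι) (Subtype.val : {i // P i} → ι)) i j = ∑ k : {i // P i}, A i.1 k.1 * A⁻¹ k.1 j.1 := rfl
  have e2 : (A * A⁻¹) i.1 j.1 = ∑ k : ι, A i.1 k * A⁻¹ k j.1 := rfl
  rw [e1, ← key, ← e2, Matrix.mul_nonsing_inv _ hA, Matrix.one_apply, Matrix.one_apply]
  simp only [Subtype.ext_iff]

/-- [folklore] **THE INVERSES OF TWO BLOCK-DIAGONAL INVERTIBLE MATRICES AGREE ON CORRESPONDING BLOCKS** when the matrices do: with blocks `P`, `P′` and an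
equivalence `e : {P} ≃ {P′}` carrying equal entries, `A⁻¹ i j = A′⁻¹ (e i) (e j)` on the block. -/
theorem inv_apply_eq_of_block_equiv {ι ι' : Type*} [Fintype ι] [DecidableEq ι] [Fintype ι'] [DecidableEq ι'] (A : Matrix ι ι ℝ) (A' : Matrix ι' ι' ℝ)
    (hA : IsUnit A.det) (hA' : IsUnit A'.det) (P : ι → Prop) [DecidablePred P] (P' : ι' → Prop) [DecidablePred P']
    (hP : ∀ i j, P i → ¬ P j → A i j = 0) (hP' : ∀ i j, P' i → ¬ P' j → A' i j = 0) (e : {i // P i} ≃ {i' // P' i'})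
    (hAA' : ∀ i j : {i // P i}, A i.1 j.1 = A' (e i).1 (e j).1) (i j : {i // P i}) :
    A⁻¹ i.1 j.1 = A'⁻¹ (e i).1 (e j).1 := by
  have h1 : A⁻¹ i.1 j.1 = ((A⁻¹).submatrix (Subtype.val : {i // P i} → ι) (Subtype.val : {i // P i} → ι)) i j := rfl
  have h2 : A'⁻¹ (e i).1 (e j).1 = (((A'⁻¹).submatrix (Subtype.val : {i' // P' i'} → ι') (Subtype.val : {i' // P' i'} → ι')).submatrix e e) i j := rfl
  rw [h1, h2, inv_submatrix_block A hA P hP, inv_submatrix_block A' hA' P' hP', ← Matrix.inv_submatrix_equiv _ e e]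
  have hm : A.submatrix (Subtype.val : {i // P i} → ι) (Subtype.val : {i // P i} → ι)
      = (A'.submatrix (Subtype.val : {i' // P' i'} → ι') (Subtype.val : {i' // P' i'} → ι')).submatrix e e := by
    ext a b; exact hAA' a b
  rw [hm]

/-- [folklore] **THE INVERSES OF TWO BLOCK-DIAGONAL INVERTIBLE MATRICES AGREE AT RELATED INDICES** — relational form of `inv_apply_eq_of_block_equiv`: a left- and right-unique
relation `R` preserving the block structure, onto between the blocks of a related pair, and carrying equal entries, carries equal inverse entries. -/
theorem inv_apply_eq_of_block_rel {ι ι' α α' : Type*} [Fintype ι] [DecidableEq ι] [Fintype ι'] [DecidableEq ι']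
    (A : Matrix ι ι ℝ) (A' : Matrix ι' ι' ℝ) (hA : IsUnit A.det) (hA' : IsUnit A'.det) (f : ι → α) (f' : ι' → α') (R : ι → ι' → Prop)
    (hru : ∀ i i' j', R i i' → R i j' → i' = j') (hlu : ∀ i j i', R i i' → R j i' → i = j)
    (hbd : ∀ i j, f i ≠ f j → A i j = 0) (hbd' : ∀ i' j', f' i' ≠ f' j' → A' i' j' = 0)
    (hAA' : ∀ i j i' j', R i i' → R j j' → A i j = A' i' j') (hblk : ∀ i j i' j', R i i' → R j j' → (f i = f j ↔ f' i' = f' j'))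
    (i j : ι) (i' j' : ι') (hi : R i i') (hj : R j j')
    (hex : ∀ k, f k = f i → ∃ k', R k k') (hex' : ∀ k', f' k' = f' i' → ∃ k, R k k') : A⁻¹ i j = A'⁻¹ i' j' := by
  classical
  by_cases hb : f j = f i
  · let g : {k // f k = f i} → {k' // f' k' = f' i'} := fun k =>
      ⟨Classical.choose (hex k.1 k.2), (hblk k.1 i _ i' (Classical.choose_spec (hex k.1 k.2)) hi).1 k.2⟩
    have hg : ∀ k : {k // f k = f i}, R k.1 (g k).1 := fun k => Classical.choose_spec (hex k.1 k.2)
    have ginj : Function.Injective g := fun x y e => Subtype.ext (hlu x.1 y.1 (g x).1 (hg x) (by rw [e]; exact hg y))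
    have gsurj : Function.Surjective g := by
      intro y
      obtain ⟨x, hx⟩ := hex' y.1 y.2
      exact ⟨⟨x, (hblk x i y.1 i' hx hi).2 y.2⟩, Subtype.ext (hru x _ _ (hg ⟨x, _⟩) hx)⟩
    have key := inv_apply_eq_of_block_equiv A A' hA hA' (fun k => f k = f i) (fun k' => f' k' = f' i')
      (fun a b ha hb' => hbd a b (by rw [ha]; exact Ne.symm hb')) (fun a b ha hb' => hbd' a b (by rw [ha]; exact Ne.symm hb'))
      (Equiv.ofBijective g ⟨ginj, gsurj⟩) (fun a b => hAA' a.1 b.1 (g a).1 (g b).1 (hg a) (hg b)) ⟨i, rfl⟩ ⟨j, hb⟩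
    rw [key, Equiv.ofBijective_apply, Equiv.ofBijective_apply, hru i _ _ (hg ⟨i, rfl⟩) hi, hru j _ _ (hg ⟨j, hb⟩) hj]
  · have hb' : f' j' ≠ f' i' := fun e => hb ((hblk j i j' i' hj hi).2 e)
    rw [inv_apply_eq_zero_of_blockDiagonal f A hbd i j (Ne.symm hb), inv_apply_eq_zero_of_blockDiagonal f' A' hbd' i' j' (Ne.symm hb')]

end Generic

/-! ## §1 The comb geometry is covariant under block translations `x ↦ x + N • w` -/

section Comb

variable {ρ : Site (d + 1)} {N : ℕ}

/-- [folklore] `quo N (x + N•w) = quo N x + w`. -/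
theorem quo_add_zsmul (hN : 0 < N) (x w : Site (d + 1)) : quo N (x + (N : ℤ) • w) = quo N x + w := by
  funext i
  have hN0 : (N : ℤ) ≠ 0 := by exact_mod_cast hN.ne'
  show (x + (N : ℤ) • w) i / (N : ℤ) = x i / (N : ℤ) + w i
  simp only [Pi.add_apply, Pi.smul_apply, smul_eq_mul]
  rw [Int.add_mul_ediv_left _ _ hN0]

/-- [folklore] the root moves with the block: `rootOf (x + N•w) = rootOf x + N•w`. -/
theorem rootOf_add_zsmul (hN : 0 < N) (x w : Site (d + 1)) : rootOf ρ N (x + (N : ℤ) • w) = rootOf ρ N x + (N : ℤ) • w := by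
  funext i
  have hq := congrFun (quo_add_zsmul hN x w) i
  change (x + (N : ℤ) • w) i / (N : ℤ) = x i / (N : ℤ) + w i at hq
  simp only [rootOf, Pi.add_apply, Pi.smul_apply, smul_eq_mul] at hq ⊢
  rw [hq]; ring

/-- [folklore] the offset from the root is translation invariant. -/
theorem sub_rootOf_add_zsmul (hN : 0 < N) (x w : Site (d + 1)) (i : Fin (d + 1)) :
    (x + (N : ℤ) • w) i - rootOf ρ N (x + (N : ℤ) • w) i = x i - rootOf ρ N x i := by
  rw [rootOf_add_zsmul hN]; simp only [Pi.add_apply]; ring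

/-- [folklore] non-roots translate to non-roots. -/
theorem ne_rootOf_add_zsmul_iff (hN : 0 < N) (x w : Site (d + 1)) : x + (N : ℤ) • w ≠ rootOf ρ N (x + (N : ℤ) • w) ↔ x ≠ rootOf ρ N x := by
  rw [rootOf_add_zsmul hN, not_iff_not]
  constructor
  · intro h; exact add_right_cancel h
  · intro h; exact congrArg (fun y => y + (N : ℤ) • w) h

/-- [folklore] the deviating coordinates are translation invariant. -/
theorem devSet_add_zsmul (hN : 0 < N) (x w : Site (d + 1)) : devSet ρ N (x + (N : ℤ) • w) = devSet ρ N x := by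
  ext i
  simp only [devSet, Finset.mem_filter, Finset.mem_univ, true_and]
  rw [← sub_ne_zero, sub_rootOf_add_zsmul hN, sub_ne_zero]

/-- [folklore] the comb axis is translation invariant. -/
theorem axisOf_add_zsmul (hN : 0 < N) (x w : Site (d + 1)) : axisOf ρ N (x + (N : ℤ) • w) = axisOf ρ N x := by
  simp only [axisOf, devSet_add_zsmul hN]

/-- [folklore] the orientation is translation invariant. -/
theorem signOf_add_zsmul (hN : 0 < N) (x w : Site (d + 1)) : signOf ρ N (x + (N : ℤ) • w) = signOf ρ N x := by
  simp only [signOf, axisOf_add_zsmul hN]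
  have e : ∀ a : Fin (d + 1), (rootOf ρ N (x + (N : ℤ) • w) a < (x + (N : ℤ) • w) a) ↔ (rootOf ρ N x a < x a) := fun a => by
    rw [← sub_pos, show (x + (N : ℤ) • w) a - rootOf ρ N (x + (N : ℤ) • w) a = x a - rootOf ρ N x a from sub_rootOf_add_zsmul hN x w a, sub_pos]
  simp only [e]

/-- [folklore] the comb predecessor is covariant: `stepOf (x + N•w) = stepOf x + N•w`. -/
theorem stepOf_add_zsmul (hN : 0 < N) (x w : Site (d + 1)) : stepOf ρ N (x + (N : ℤ) • w) = stepOf ρ N x + (N : ℤ) • w := by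
  funext j
  rw [Pi.add_apply, stepOf_apply, stepOf_apply, axisOf_add_zsmul hN, signOf_add_zsmul hN]
  split_ifs with h
  · subst h; simp only [Pi.add_apply]; ring
  · rfl

/-- [folklore] the base point of the comb bond is covariant. -/
theorem baseOf_add_zsmul (hN : 0 < N) (x w : Site (d + 1)) : baseOf ρ N (x + (N : ℤ) • w) = baseOf ρ N x + (N : ℤ) • w := by
  have e : (rootOf ρ N (x + (N : ℤ) • w) (axisOf ρ N (x + (N : ℤ) • w)) < (x + (N : ℤ) • w) (axisOf ρ N (x + (N : ℤ) • w)))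
      ↔ (rootOf ρ N x (axisOf ρ N x) < x (axisOf ρ N x)) := by
    rw [axisOf_add_zsmul hN, ← sub_pos, sub_rootOf_add_zsmul hN x w, sub_pos]
  by_cases h : rootOf ρ N x (axisOf ρ N x) < x (axisOf ρ N x)
  · rw [baseOf, if_pos (e.2 h), baseOf, if_pos h, stepOf_add_zsmul hN]
  · rw [baseOf, if_neg (fun h' => h (e.1 h')), baseOf, if_neg h]

/-- [folklore] the tip of the comb bond is covariant. -/
theorem tipOf_add_zsmul (hN : 0 < N) (x w : Site (d + 1)) : tipOf ρ N (x + (N : ℤ) • w) = tipOf ρ N x + (N : ℤ) • w := by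
  simp only [tipOf, baseOf_add_zsmul hN, axisOf_add_zsmul hN]
  abel

/-- [folklore] translating by a multiple `N•(K•w)` of a coarser blocking: the comb data at ratio `N` are covariant (`N•(K•w) = N•w′`). -/
theorem zsmul_zsmul_eq (N K : ℕ) (w : Site (d + 1)) : ((N * K : ℕ) : ℤ) • w = (N : ℤ) • ((K : ℤ) • w) := by
  rw [smul_smul, Nat.cast_mul]

end Comb

/-! ## §2 The slot correspondence between two towers under a block translation -/

section Slots

variable (Lc : ℕ) [NeZero Lc]

omit [NeZero Lc] in
/-- [folklore] `bigRatio Lc (k+1) • v = bigRatio Lc k • (Lc • v)` — the finest shift of the tower over `M` (blocks moved by `v`, top sites by `Lc • v`) IS the finest shift of the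
lower tower over `fine Lc M` (whose top sites move by `Lc • (Lc • v)`). -/
theorem bigRatio_succ_zsmul (k : ℕ) (v : Site (d + 1)) : ((bigRatio Lc (k + 1) : ℕ) : ℤ) • v = ((bigRatio Lc k : ℕ) : ℤ) • ((Lc : ℤ) • v) := by
  rw [bigRatio_succ, zsmul_zsmul_eq]

/-- [folklore] **A TOP SLOT CORRESPONDS ONLY TO A TOP SLOT**: if the site of a slot `p′` of the tower over `M′` is the site of the top slot `inl t̄` of the tower over `M`
moved by `bigRatio Lc (k+1) • v`, then `p′ = inl t̄′` with `t̄′ = t̄ + Lc • v` (a lower slot's site is a NON-root of the lower big comb, a top slot's site is a root of it). -/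
theorem corr_succ_inl (M M' : Fin (d + 1) → ℕ) (rs : ℕ → (Fin (d + 1) → ℕ)) (hrs : ∀ j i, 0 ≤ toSite (rs j) i ∧ toSite (rs j) i < (Lc : ℤ))
    (k : ℕ) (v : Site (d + 1)) (t : Res (toSite (rs 0)) Lc M) (p' : NParam Lc M' rs (k + 1))
    (h : ((towerEquiv Lc M' rs hrs (k + 1)).symm p').site = ((towerEquiv Lc M rs hrs (k + 1)).symm (Sum.inl t)).site + ((bigRatio Lc (k + 1) : ℕ) : ℤ) • v) :
    ∃ t' : Res (toSite (rs 0)) Lc M', p' = Sum.inl t' ∧ t'.site = t.site + (Lc : ℤ) • v := by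
  have hLc : 0 < Lc := Nat.pos_of_ne_zero (NeZero.ne Lc)
  have hR : 0 < bigRatio Lc k := bigRatio_pos Lc hLc k
  have hρ := bigRoot_range Lc hLc k (fun j => rs (j + 1)) (fun j => hrs (j + 1))
  rw [towerEquiv_symm_inl_site, bigRatio_succ_zsmul, add_assoc, add_comm (bigRoot Lc _ k), ← add_assoc, ← smul_add] at h
  rcases p' with t' | x'
  · refine ⟨t', rfl, ?_⟩
    rw [towerEquiv_symm_inl_site] at h
    have h2 := congrArg (quo (bigRatio Lc k)) h
    rwa [quo_lift hR hρ, quo_lift hR hρ] at h2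
  · exfalso
    rw [towerEquiv_symm_inr_site] at h
    have hnr := ((towerEquiv Lc (fine Lc M') (fun j => rs (j + 1)) (fun j => hrs (j + 1)) k).symm x').not_root
    apply hnr
    rw [h]
    exact lift_eq_rootOf hR hρ (t.site + (Lc : ℤ) • v)

/-- [folklore] **A LOWER SLOT CORRESPONDS ONLY TO A LOWER SLOT**, and the lower sites then correspond under the lower tower's finest shift `bigRatio Lc k • (Lc • v)`. -/
theorem corr_succ_inr (M M' : Fin (d + 1) → ℕ) (rs : ℕ → (Fin (d + 1) → ℕ)) (hrs : ∀ j i, 0 ≤ toSite (rs j) i ∧ toSite (rs j) i < (Lc : ℤ))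
    (k : ℕ) (v : Site (d + 1)) (x : NParam Lc (fine Lc M) (fun j => rs (j + 1)) k) (p' : NParam Lc M' rs (k + 1))
    (h : ((towerEquiv Lc M' rs hrs (k + 1)).symm p').site = ((towerEquiv Lc M rs hrs (k + 1)).symm (Sum.inr x)).site + ((bigRatio Lc (k + 1) : ℕ) : ℤ) • v) :
    ∃ x' : NParam Lc (fine Lc M') (fun j => rs (j + 1)) k, p' = Sum.inr x' ∧
      ((towerEquiv Lc (fine Lc M') (fun j => rs (j + 1)) (fun j => hrs (j + 1)) k).symm x').site
        = ((towerEquiv Lc (fine Lc M) (fun j => rs (j + 1)) (fun j => hrs (j + 1)) k).symm x).site + ((bigRatio Lc k : ℕ) : ℤ) • ((Lc : ℤ) • v) := by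
  have hLc : 0 < Lc := Nat.pos_of_ne_zero (NeZero.ne Lc)
  have hR : 0 < bigRatio Lc k := bigRatio_pos Lc hLc k
  have hρ := bigRoot_range Lc hLc k (fun j => rs (j + 1)) (fun j => hrs (j + 1))
  rw [bigRatio_succ_zsmul] at h
  rcases p' with t' | x'
  · exfalso
    have hnr := ((towerEquiv Lc (fine Lc M) (fun j => rs (j + 1)) (fun j => hrs (j + 1)) k).symm x).not_root
    rw [towerEquiv_symm_inl_site, towerEquiv_symm_inr_site] at h
    -- the site of `inr x` is the root-type point `R'•t̄' + ρ'` moved back by `R'•(Lc•v)`: a root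
    have e : ((towerEquiv Lc (fine Lc M) (fun j => rs (j + 1)) (fun j => hrs (j + 1)) k).symm x).site
        = ((bigRatio Lc k : ℕ) : ℤ) • (t'.site - (Lc : ℤ) • v) + bigRoot Lc (fun j => rs (j + 1)) k := by
      rw [smul_sub, eq_sub_of_add_eq h.symm]
      abel
    apply hnr
    rw [e]
    exact lift_eq_rootOf hR hρ (t'.site - (Lc : ℤ) • v)
  · refine ⟨x', rfl, ?_⟩
    rw [towerEquiv_symm_inr_site, towerEquiv_symm_inr_site] at h
    exact h

end Slots

end Summit.QuantumFields.BalabanUV.Beta.FP.TorusCombTranslate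

end
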